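import Summits.AtomisticToContinuum.Crystallization.Theorems.PhononSlackCertificatesPeriodicGivenLayeredLayerCake4

/-!
# `CleanLimitsHaveWindows` (stmt-AtomisticToContinuum-15932), line `Sketch`, helper for stub `stub_layerCakeBand`:
# the layer cake on the clean band, part 1 (heights, separation, decay and summability of the layer sums)

Support file for the crux `GappedShellCensus.CleanLimitsHaveWindows`. The stub `stub_layerCakeBand` is the layer-cake
bookkeeping `LayeredHull.stub_layerCake` of exactly layered sets
`S(A, s, z) = {A (i u(a) + j v(a) + L(m) w(a) + z(m) e₃)}` (`L = haggLabel s`) transported from the box of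
`PeriodicGivenLayered` (`a ∈ [47/50, 1]`, increments of `z` in `[39a/50, 17a/20]`) to the CLEAN BAND: in-plane spacing
`a ∈ [9/10, 11/10]`, any word `s`, heights with increments `≥ 7a/10` and no upper bound. This part re-derives, with
the constants of the band, the facts of `…LayerCake1–3` whose hypotheses hard-code the box:

* heights: increments `≥ 7a/10` are increments `≥ 39a'/50` for `a' = 35a/39`, so the `cake_*` height lemmas apply;
  distinct layers are `≥ 7a/10 ≥ 63/100` apart (`cakeB_height_sep`, `cakeB_height_sep'`);
* `1/2`-separation of `S(A, s, z)` (`cakeB_separated`);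
* the inverse-cube layer sum `∑ (‖layerVec a H δ 1 p q‖²)⁻³ ≤ 240 / H⁴` for `a ≥ 9/10`, `|H| ≥ 63/100`
  (`cakeB_sum_layer_inv_cube_le`): monotonicity in `a` reduces to `a = 9/10`, and the scaling
  `‖layerVec (9/10) H δ‖² = (9/10)² ‖layerVec 1 (10H/9) δ‖²` to `cake_sum_layer_inv_cube_le` at spacing `1` and
  height `10H/9 ≥ 7/10`;
* `|V_LJ(r)| ≤ 2 r⁻⁶` for `r² ≥ 9/25`, hence `∑ |V_LJ ‖layerVec a H δ 1 p q‖| ≤ 480 / H⁴` and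
  `|layerInteraction V_LJ a H δ 1| ≤ 480 / H⁴` (`cakeB_abs_layerInteraction_le`), absolute summability of the in-layer
  family (`cakeB_summable_abs_inLayer`), and summability over the layers (`cakeB_summable_of_layer_bound`,
  `cakeB_summable_layers`).
-/

namespace Summit.AtomisticToContinuum.Crystallization.Theorems.CleanHull

open Literature.MathematicalPhysics.StatisticalMechanics
open Summit.AtomisticToContinuum.Crystallization.Theorems.LayeredHull

/-! ## Heights with increments `≥ 7a/10` -/

/-- Increments `≥ 7a/10` are increments `≥ 39a'/50` for `a' = 35a/39`. [folklore] -/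
theorem cakeB_hz (a : ℝ) (z : ℤ → ℝ) (hz : ∀ m : ℤ, 7 / 10 * a ≤ z (m + 1) - z m) (m : ℤ) :
    39 / 50 * (35 * a / 39) ≤ z (m + 1) - z m := by
  have := hz m
  linarith

/-- `|z m' - z m| ≥ (7a/10) |m' - m|` for heights with increments `≥ 7a/10` (`a ≥ 0`). [folklore] -/
theorem cakeB_abs_height_diff_ge (a : ℝ) (ha : 0 ≤ a) (z : ℤ → ℝ)
    (hz : ∀ m : ℤ, 7 / 10 * a ≤ z (m + 1) - z m) (m m' : ℤ) :
    7 / 10 * a * |((m' : ℝ) - m)| ≤ |z m' - z m| := by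
  have h := cake_abs_height_diff_ge (35 * a / 39) (by positivity) z (cakeB_hz a z hz) m m'
  have e : (39 : ℝ) / 50 * (35 * a / 39) = 7 / 10 * a := by ring
  rwa [e] at h

/-- Heights with increments `≥ 7a/10` (`a > 0`) are injective. [folklore] -/
theorem cakeB_height_injective (a : ℝ) (ha : 0 < a) (z : ℤ → ℝ)
    (hz : ∀ m : ℤ, 7 / 10 * a ≤ z (m + 1) - z m) : Function.Injective z :=
  cake_height_injective (35 * a / 39) (by positivity) z (cakeB_hz a z hz)

/-- Distinct layers are vertically `≥ 7a/10` apart. [folklore] -/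
theorem cakeB_height_sep (a : ℝ) (ha : 0 ≤ a) (z : ℤ → ℝ)
    (hz : ∀ m : ℤ, 7 / 10 * a ≤ z (m + 1) - z m) {m m' : ℤ} (hne : m' ≠ m) :
    7 / 10 * a ≤ |z m' - z m| := by
  have h1 := cakeB_abs_height_diff_ge a ha z hz m m'
  have h2 : (1 : ℝ) ≤ |((m' : ℝ) - m)| := by
    rw [← Int.cast_sub, ← Int.cast_abs]
    exact_mod_cast Int.one_le_abs (sub_ne_zero.2 hne)
  nlinarith

/-- Distinct layers are vertically `≥ 63/100` apart when `a ≥ 9/10`. [folklore] -/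
theorem cakeB_height_sep' (a : ℝ) (ha : 9 / 10 ≤ a) (z : ℤ → ℝ)
    (hz : ∀ m : ℤ, 7 / 10 * a ≤ z (m + 1) - z m) {m m' : ℤ} (hne : m' ≠ m) :
    63 / 100 ≤ |z m' - z m| := by
  have := cakeB_height_sep a (by linarith) z hz hne
  linarith

/-! ## Separation -/

/-- **`1/2`-separation of a layered set on the band.** For `a ≥ 9/10`, any linear isometry `A`, any word `s` and
heights with increments `≥ 7a/10`, distinct points of `S(A, s, z)` are at distance `≥ 1/2` (same layer: `≥ a`;
different layers: vertical distance `≥ 63/100`). [folklore] -/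
theorem cakeB_separated (a : ℝ) (ha : 9 / 10 ≤ a)
    (A : EuclideanSpace ℝ (Fin 3) →ₗᵢ[ℝ] EuclideanSpace ℝ (Fin 3)) (s : ℤ → ℤ) (z : ℤ → ℝ)
    (hz : ∀ m : ℤ, 7 / 10 * a ≤ z (m + 1) - z m) :
    ∀ p ∈ {p : EuclideanSpace ℝ (Fin 3) | ∃ m i j : ℤ, p = A (((i : ℝ) • triangularVec₁ a) +
        ((j : ℝ) • triangularVec₂ a) + ((haggLabel s m : ℝ) • barlowOffset a) + (z m • layerNormal 1))},
      ∀ q ∈ {p : EuclideanSpace ℝ (Fin 3) | ∃ m i j : ℤ, p = A (((i : ℝ) • triangularVec₁ a) +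
        ((j : ℝ) • triangularVec₂ a) + ((haggLabel s m : ℝ) • barlowOffset a) + (z m • layerNormal 1))},
      p ≠ q → 1 / 2 ≤ dist p q := by
  rintro p ⟨m, i, j, rfl⟩ q ⟨m', i', j', rfl⟩ hne
  rw [cake_pt_eq_layerVec, cake_pt_eq_layerVec] at hne ⊢
  rw [LinearIsometry.dist_map, dist_comm, dist_eq_norm, cake_layerVec_sub]
  by_cases hm : m' = m
  · subst hm
    have hij : (i' - i, j' - j) ≠ 0 := by
      intro h0
      simp only [Prod.mk_eq_zero, sub_eq_zero] at h0
      obtain ⟨rfl, rfl⟩ := h0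
      exact hne rfl
    rw [sub_self, sub_self]
    have := cake_le_norm_layerVec_inLayer a (by linarith) hij
    linarith
  · have h1 := cake_abs_height_le_norm a (z m' - z m) (haggLabel s m' - haggLabel s m) (i' - i) (j' - j)
    have h2 := cakeB_height_sep' a ha z hz hm
    linarith

/-! ## The inverse-cube layer sum on the band -/

/-- Monotonicity of `‖layerVec a H δ 1 p q‖²` in the spacing `a ≥ 0`. [folklore] -/
theorem cakeB_norm_layerVec_sq_mono {a a' : ℝ} (ha : 0 ≤ a) (haa' : a ≤ a') (H : ℝ) (δ p q : ℤ) :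
    ‖layerVec a H δ 1 p q‖ ^ 2 ≤ ‖layerVec a' H δ 1 p q‖ ^ 2 := by
  rw [cake_norm_layerVec_sq, cake_norm_layerVec_sq]
  have h1 : a ^ 2 ≤ a' ^ 2 := pow_le_pow_left₀ ha haa' 2
  nlinarith [sq_nonneg ((p : ℝ) + ((q : ℝ) / 2 + (δ : ℝ) / 2)), sq_nonneg ((q : ℝ) + (δ : ℝ) / 3)]

/-- Scaling of lengths: `‖layerVec a H δ 1 p q‖² = a² ‖layerVec 1 (H/a) δ 1 p q‖²` (`a ≠ 0`). [folklore] -/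
theorem cakeB_norm_layerVec_sq_scale (a H : ℝ) (ha : a ≠ 0) (δ p q : ℤ) :
    ‖layerVec a H δ 1 p q‖ ^ 2 = a ^ 2 * ‖layerVec 1 (H / a) δ 1 p q‖ ^ 2 := by
  rw [cake_norm_layerVec_sq, cake_norm_layerVec_sq]
  field_simp

/-- The squared norms are positive once `H ≠ 0`. [folklore] -/
theorem cakeB_norm_layerVec_sq_pos (a H : ℝ) (hH : H ≠ 0) (δ p q : ℤ) : 0 < ‖layerVec a H δ 1 p q‖ ^ 2 := by
  have h1 := cake_abs_height_le_norm a H δ p q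
  have h2 : 0 < |H| := abs_pos.2 hH
  have h3 : 0 < ‖layerVec a H δ 1 p q‖ := h2.trans_le h1
  positivity

/-- **The inverse-cube layer sum on the band.** For `a ≥ 9/10`, `|H| ≥ 63/100`, any offset `δ` and any finite
`u ⊆ ℤ²`: `∑_{(p,q) ∈ u} (‖layerVec a H δ 1 p q‖²)⁻³ ≤ 240 / H⁴` (monotonicity down to `a = 9/10`, scaling to
spacing `1` and height `10H/9`, and `cake_sum_layer_inv_cube_le`: `(10/9)² · 192 ≤ 240`). [folklore] -/
theorem cakeB_sum_layer_inv_cube_le (a H : ℝ) (ha : 9 / 10 ≤ a) (hH : 63 / 100 ≤ |H|)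
    (δ : ℤ) (u : Finset (ℤ × ℤ)) :
    ∑ pq ∈ u, ((‖layerVec a H δ 1 pq.1 pq.2‖ ^ 2)⁻¹) ^ 3 ≤ 240 / H ^ 4 := by
  have hHne : H ≠ 0 := by
    rintro rfl
    rw [abs_zero] at hH
    linarith
  have hH' : 7 / 10 ≤ |H / (9 / 10)| := by
    rw [abs_div, abs_of_pos (by norm_num : (0 : ℝ) < 9 / 10), le_div_iff₀ (by norm_num)]
    linarith
  have key := cake_sum_layer_inv_cube_le 1 (H / (9 / 10)) (by norm_num) le_rfl hH' δ u
  have hpt : ∀ pq : ℤ × ℤ, ((‖layerVec a H δ 1 pq.1 pq.2‖ ^ 2)⁻¹) ^ 3 ≤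
      (((9 / 10 : ℝ) ^ 2)⁻¹) ^ 3 * ((‖layerVec 1 (H / (9 / 10)) δ 1 pq.1 pq.2‖ ^ 2)⁻¹) ^ 3 := by
    intro pq
    rw [← mul_pow, ← mul_inv, ← cakeB_norm_layerVec_sq_scale (9 / 10) H (by norm_num)]
    refine pow_le_pow_left₀ (by positivity) ?_ 3
    exact inv_anti₀ (cakeB_norm_layerVec_sq_pos _ H hHne δ _ _)
      (cakeB_norm_layerVec_sq_mono (by norm_num) ha H δ pq.1 pq.2)
  have hH4 : 0 < H ^ 4 := by positivity
  calc ∑ pq ∈ u, ((‖layerVec a H δ 1 pq.1 pq.2‖ ^ 2)⁻¹) ^ 3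
      ≤ ∑ pq ∈ u, (((9 / 10 : ℝ) ^ 2)⁻¹) ^ 3 * ((‖layerVec 1 (H / (9 / 10)) δ 1 pq.1 pq.2‖ ^ 2)⁻¹) ^ 3 :=
        Finset.sum_le_sum fun pq _ => hpt pq
    _ = (((9 / 10 : ℝ) ^ 2)⁻¹) ^ 3 * ∑ pq ∈ u, ((‖layerVec 1 (H / (9 / 10)) δ 1 pq.1 pq.2‖ ^ 2)⁻¹) ^ 3 := by
        rw [Finset.mul_sum]
    _ ≤ (((9 / 10 : ℝ) ^ 2)⁻¹) ^ 3 * (192 / (H / (9 / 10)) ^ 4) :=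
        mul_le_mul_of_nonneg_left key (by positivity)
    _ = (10 / 9) ^ 2 * 192 / H ^ 4 := by
        field_simp
    _ ≤ 240 / H ^ 4 := by
        rw [div_le_div_iff_of_pos_right hH4]
        norm_num

/-! ## The Lennard-Jones potential beyond `3/5` -/

/-- `|V_LJ(r)| ≤ 2 (r²)⁻³` as soon as `r² ≥ 9/25` (then `u = r⁻⁶ ≤ (25/9)³ < 26`, and `|u²/12 - u/6| ≤ 2u` for
`0 ≤ u ≤ 26`). [folklore] -/
theorem cakeB_abs_lennardJones_le {r : ℝ} (h : 9 / 25 ≤ r ^ 2) :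
    |lennardJones r| ≤ 2 * ((r ^ 2)⁻¹) ^ 3 := by
  set u : ℝ := ((r ^ 2)⁻¹) ^ 3 with hu
  have hr2 : 0 < r ^ 2 := by linarith
  have hu0 : 0 ≤ u := by positivity
  have hinv : (r ^ 2)⁻¹ ≤ 25 / 9 := by
    rw [inv_eq_one_div, div_le_div_iff₀ hr2 (by norm_num)]; linarith
  have hu1 : u ≤ (25 / 9) ^ 3 := by
    rw [hu]; exact pow_le_pow_left₀ (by positivity) hinv 3
  have hLJ : lennardJones r = u ^ 2 / 12 - u / 6 := by
    unfold lennardJones; rw [hu]; ring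
  rw [hLJ, abs_le]
  constructor <;> nlinarith [hu0, hu1, mul_nonneg hu0 hu0, mul_nonneg hu0 (sub_nonneg.2 hu1)]

/-- Pointwise bound of the layer terms: `|V_LJ ‖layerVec a H δ 1 p q‖| ≤ 2 (‖layerVec a H δ 1 p q‖²)⁻³` for
`|H| ≥ 63/100`. [folklore] -/
theorem cakeB_abs_lennardJones_layerVec_le (a H : ℝ) (hH : 63 / 100 ≤ |H|) (δ p q : ℤ) :
    |lennardJones ‖layerVec a H δ 1 p q‖| ≤ 2 * ((‖layerVec a H δ 1 p q‖ ^ 2)⁻¹) ^ 3 := by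
  apply cakeB_abs_lennardJones_le
  have h1 := cake_abs_height_le_norm a H δ p q
  have h2 : (63 / 100 : ℝ) ^ 2 ≤ ‖layerVec a H δ 1 p q‖ ^ 2 := pow_le_pow_left₀ (by norm_num) (hH.trans h1) 2
  nlinarith

/-! ## Decay of the layer sums -/

/-- **Absolute summability and decay of a layer sum on the band.** For `a ≥ 9/10`, `|H| ≥ 63/100`, any offset
`δ`: `∑_{(p,q) ∈ ℤ²} |V_LJ ‖layerVec a H δ 1 p q‖| ≤ 480 / H⁴` (and the family is summable). [folklore] -/
theorem cakeB_summable_abs_layer (a H : ℝ) (ha : 9 / 10 ≤ a) (hH : 63 / 100 ≤ |H|) (δ : ℤ) :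
    Summable (fun pq : ℤ × ℤ => |lennardJones ‖layerVec a H δ 1 pq.1 pq.2‖|) ∧
      ∑' pq : ℤ × ℤ, |lennardJones ‖layerVec a H δ 1 pq.1 pq.2‖| ≤ 480 / H ^ 4 := by
  have hle : ∀ u : Finset (ℤ × ℤ),
      ∑ pq ∈ u, |lennardJones ‖layerVec a H δ 1 pq.1 pq.2‖| ≤ 480 / H ^ 4 := fun u =>
    calc ∑ pq ∈ u, |lennardJones ‖layerVec a H δ 1 pq.1 pq.2‖|
        ≤ ∑ pq ∈ u, 2 * ((‖layerVec a H δ 1 pq.1 pq.2‖ ^ 2)⁻¹) ^ 3 :=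
          Finset.sum_le_sum fun pq _ => cakeB_abs_lennardJones_layerVec_le a H hH δ pq.1 pq.2
      _ = 2 * ∑ pq ∈ u, ((‖layerVec a H δ 1 pq.1 pq.2‖ ^ 2)⁻¹) ^ 3 := by rw [Finset.mul_sum]
      _ ≤ 2 * (240 / H ^ 4) := mul_le_mul_of_nonneg_left (cakeB_sum_layer_inv_cube_le a H ha hH δ u) (by norm_num)
      _ = 480 / H ^ 4 := by ring
  exact ⟨summable_of_sum_le (fun _ => abs_nonneg _) hle, Real.tsum_le_of_sum_le (fun _ => abs_nonneg _) hle⟩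

/-- **Decay of the layer interaction on the band.** `|layerInteraction lennardJones a H δ 1| ≤ 480 / H⁴` for
`a ≥ 9/10`, `|H| ≥ 63/100`, any offset `δ`. [folklore] -/
theorem cakeB_abs_layerInteraction_le (a H : ℝ) (ha : 9 / 10 ≤ a) (hH : 63 / 100 ≤ |H|) (δ : ℤ) :
    |layerInteraction lennardJones a H δ 1| ≤ 480 / H ^ 4 := by
  obtain ⟨hs, ht⟩ := cakeB_summable_abs_layer a H ha hH δ
  unfold layerInteraction
  have h1 : ‖∑' pq : ℤ × ℤ, lennardJones ‖layerVec a H δ 1 pq.1 pq.2‖‖ ≤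
      ∑' pq : ℤ × ℤ, ‖lennardJones ‖layerVec a H δ 1 pq.1 pq.2‖‖ :=
    norm_tsum_le_tsum_norm (by simpa only [Real.norm_eq_abs] using hs)
  simp only [Real.norm_eq_abs] at h1
  exact h1.trans ht

/-! ## The in-layer family -/

/-- **Absolute summability of the in-layer family** `V_LJ ‖layerVec a 0 0 1 p q‖ = V_LJ ‖p u + q v‖` for `a ≥ 9/10`
(the origin contributes `V_LJ 0 = 0`; off the origin `‖p u + q v‖² ≥ a²`, and the term is dominated by `16` times the
inverse-cube layer term at the fictitious height `H = a`). [folklore] -/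
theorem cakeB_summable_abs_inLayer (a : ℝ) (ha : 9 / 10 ≤ a) :
    Summable (fun pq : ℤ × ℤ => |lennardJones ‖layerVec a 0 0 1 pq.1 pq.2‖|) := by
  have ha0 : 0 < a := by linarith
  have haH : 63 / 100 ≤ |a| := by rw [abs_of_pos ha0]; linarith
  have hT : Summable (fun pq : ℤ × ℤ => 16 * ((‖layerVec a a 0 1 pq.1 pq.2‖ ^ 2)⁻¹) ^ 3) :=
    (summable_of_sum_le (fun _ => by positivity) (cakeB_sum_layer_inv_cube_le a a ha haH 0)).mul_left 16
  refine Summable.of_nonneg_of_le (fun _ => abs_nonneg _) (fun pq => ?_) hT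
  rcases eq_or_ne (pq.1, pq.2) 0 with h0 | h0
  · have h1 : pq.1 = 0 ∧ pq.2 = 0 := by simpa [Prod.ext_iff] using h0
    have hn : ‖layerVec a 0 0 1 pq.1 pq.2‖ = 0 := by
      have := cake_norm_layerVec_inLayer_sq a pq.1 pq.2
      rw [h1.1, h1.2] at this ⊢
      simpa using this
    rw [hn, lennardJones_zero, abs_zero]
    positivity
  · have hQ : (1 : ℝ) ≤ ((pq.1 ^ 2 + pq.1 * pq.2 + pq.2 ^ 2 : ℤ) : ℝ) := by
      exact_mod_cast one_le_sq_add_mul_add_sq h0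
    push_cast at hQ
    set S := ‖layerVec a 0 0 1 pq.1 pq.2‖ ^ 2 with hS
    have hS' : S = a ^ 2 * ((pq.1 : ℝ) ^ 2 + pq.1 * pq.2 + pq.2 ^ 2) :=
      cake_norm_layerVec_inLayer_sq a pq.1 pq.2
    have hSa : a ^ 2 ≤ S := by rw [hS']; nlinarith [sq_nonneg a]
    have ha2 : 81 / 100 ≤ a ^ 2 := by nlinarith
    have hS36 : 9 / 25 ≤ S := by linarith
    have hsum : ‖layerVec a a 0 1 pq.1 pq.2‖ ^ 2 = S + a ^ 2 := by
      rw [cake_norm_layerVec_sq, hS']; push_cast; ring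
    have hSpos : 0 < S := by linarith
    have hinv : S⁻¹ ≤ ((S + a ^ 2) / 2)⁻¹ := inv_anti₀ (by positivity) (by linarith)
    calc |lennardJones ‖layerVec a 0 0 1 pq.1 pq.2‖| ≤ 2 * (S⁻¹) ^ 3 := cakeB_abs_lennardJones_le hS36
      _ ≤ 2 * (((S + a ^ 2) / 2)⁻¹) ^ 3 :=
          mul_le_mul_of_nonneg_left (pow_le_pow_left₀ (by positivity) hinv 3) (by norm_num)
      _ = 16 * ((‖layerVec a a 0 1 pq.1 pq.2‖ ^ 2)⁻¹) ^ 3 := by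
          rw [hsum, inv_div, div_pow, inv_pow]
          ring

/-! ## Sums over the layers -/

/-- **Summation over the layers on the band.** If `|f m'| ≤ 480 / (z m' - z m)⁴` for `m' ≠ m` and the heights have
increments `≥ 7a/10` (`a > 0`), then `f` is summable over `ℤ` (comparison with `C / (m' - m)⁴`). [folklore] -/
theorem cakeB_summable_of_layer_bound (a : ℝ) (ha : 0 < a) (z : ℤ → ℝ)
    (hz : ∀ m : ℤ, 7 / 10 * a ≤ z (m + 1) - z m) (m : ℤ) (f : ℤ → ℝ)
    (hf : ∀ m', m' ≠ m → |f m'| ≤ 480 / (z m' - z m) ^ 4) : Summable f := by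
  set c : ℝ := 7 / 10 * a with hc
  have hcpos : 0 < c := by rw [hc]; positivity
  have h4 : Summable fun n : ℤ => 1 / (n : ℝ) ^ 4 := Real.summable_one_div_int_pow.2 (by norm_num)
  have h5 : Summable fun m' : ℤ => 1 / (((m' - m : ℤ) : ℝ)) ^ 4 := by
    have h5' := h4.comp_injective (sub_left_injective (b := m))
    refine h5'.congr fun m' => ?_
    simp only [Function.comp_apply]
  have h6 : Summable fun m' : ℤ => if m' = m then |f m| else (0 : ℝ) :=
    summable_of_ne_finset_zero (s := {m}) fun m' hm' => by
      rw [Finset.mem_singleton] at hm'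
      rw [if_neg hm']
  have hg : Summable fun m' : ℤ =>
      480 / c ^ 4 * (1 / (((m' - m : ℤ) : ℝ)) ^ 4) + (if m' = m then |f m| else 0) :=
    (h5.mul_left _).add h6
  refine Summable.of_norm_bounded hg fun m' => ?_
  rw [Real.norm_eq_abs]
  by_cases hm : m' = m
  · rw [if_pos hm, hm]
    have : (0 : ℝ) ≤ 480 / c ^ 4 * (1 / (((m - m : ℤ) : ℝ)) ^ 4) := by positivity
    linarith
  · rw [if_neg hm, add_zero]
    refine (hf m' hm).trans ?_
    have h2 := cakeB_abs_height_diff_ge a ha.le z hz m m'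
    have hne : (0 : ℝ) < |((m' : ℝ) - m)| := abs_pos.2 (sub_ne_zero.2 (by exact_mod_cast hm))
    have h3 : (c * |((m' : ℝ) - m)|) ^ 4 ≤ (z m' - z m) ^ 4 := by
      rw [← abs_of_nonneg (by positivity : (0 : ℝ) ≤ (z m' - z m) ^ 4), ← pow_abs]
      exact pow_le_pow_left₀ (by positivity) h2 4
    calc 480 / (z m' - z m) ^ 4 ≤ 480 / (c * |((m' : ℝ) - m)|) ^ 4 :=
          div_le_div_of_nonneg_left (by norm_num) (pow_pos (mul_pos hcpos hne) 4) h3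
      _ = 480 / c ^ 4 * (1 / (((m' - m : ℤ) : ℝ)) ^ 4) := by
          push_cast
          rw [mul_pow, pow_abs, abs_of_nonneg (by positivity : (0 : ℝ) ≤ ((m' : ℝ) - m) ^ 4)]
          field_simp

/-- **Summability over the layers of the layer interactions** seen from layer `m`, for `a ≥ 9/10` and heights with
increments `≥ 7a/10`. [folklore] -/
theorem cakeB_summable_layers (a : ℝ) (ha : 9 / 10 ≤ a) (s : ℤ → ℤ) (z : ℤ → ℝ)
    (hz : ∀ m : ℤ, 7 / 10 * a ≤ z (m + 1) - z m) (m : ℤ) :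
    Summable fun m' : ℤ => if m' = m then (0 : ℝ) else
      layerInteraction lennardJones a (z m' - z m) (haggLabel s m' - haggLabel s m) 1 := by
  refine cakeB_summable_of_layer_bound a (by linarith) z hz m _ fun m' hm => ?_
  rw [if_neg hm]
  exact cakeB_abs_layerInteraction_le a _ ha (cakeB_height_sep' a ha z hz hm) _

end Summit.AtomisticToContinuum.Crystallization.Theorems.CleanHull
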